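import Literature.NumberTheory.EllipticCurves.HalfIntegralWeightThetaTransformation
import Literature.NumberTheory.EllipticCurves.HalfIntegralWeightFormsThetaMultiplierProofs
import Summits.BirchSwinnertonDyer.BirchSwinnertonDyer.Theorems.PrintCFramBottomClassIndexLawFiveLeFlipRungTransportReading
import HarnessLib

set_option autoImplicit false

/-!
# Crux `PrintCFram.BottomClassIndexLawFiveLe` (stmt-BirchSwinnertonDyer-20372), line `eisenstein-resource-bdp-line` (registry v29):
# T6 «THE 2-ADIC FLIPPED-CUSP RUNG», piece P4b — THE FACTORISATION `V ∣ γ₀ = Θ · B` AT THE FLIPPED CUSP AND THE θ-FACTOR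
# (cell `bsd-print-cfram`, width seat `bsd-line-cfram-p1-w5` g8; THEOREMS ONLY, `--supports` 20372; BSD is not proved by any of this)

HONEST FRAMING. Pure bookkeeping about Shimura's `θ`, principal square roots and the weight-`(k+1)` slash; nothing here is a statement
about elliptic curves, Bernoulli numbers or BSD; no registered stub is closed. Piece P4 of w7 g8's architecture of the 2-adic rung
(crux notes `…-w7g8-T6.md` v4 §5d): the Katz vehicle `V = P·θ` (`P = classProj c g`, P2) read at `γ₀ = [a b; M 64] ∈ SL₂(ℤ)` (`M` the odd
level) must be put in the shape `(V ∣_{k+1} γ₀)(z) = Θ(z)·B(z)` of w3 g19's NF-Q transport `exists_isIntegral_qExpansion_coeff_of_slash_eq_mul`,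
with `Θ` a `q`-series with unit constant term and `B` the NORMALISED bracket of P1/P3. Writing `X = Mz + 64` (so `X/8 = 8(Mw+1)` at `z = 64w`,
P1's base):
* §1 THE BRANCH CONSTANT: `√(2iM/X)·√(X/8) = √(iM/4)` for `X ∈ ℍ` (the tree's `csqrt_div_mul_csqrt`; no sign), so the prefactor `(2iM/X)^{−1/2}`
  of `shimuraTheta_smul_eq_tsum` and P1's `√(X/8)` combine to a CONSTANT;
* §2 **`shimuraTheta_flippedCusp_mul_inv_csqrt`**: `θ(γ₀•z)·(√(X/8))⁻¹ = (√(iM/4))⁻¹ · Σ'_k exp(πi k² X/(2M))·G(a,k;M)`, the termwise split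
  `exp(πi k² X/(2M)) = e(z/4)^{k²}·exp(32πi k²/M)` — so `Θ(z) := θ(γ₀•z)·(√(X/8))⁻¹` is a series in `e(z/4)` (at `z = 64w`: `e(16k²w)`) whose
  constant term is `(√(iM/4))⁻¹·G(a;M)`, a unit of `ℤ̄[1/N]` by P4a (`exists_inverse_quadGaussSum_of_det`) and §3;
* §3 `(√(iM/4))⁻¹` is a unit of `ℤ̄[1/N]` for `2 ∣ N`, `M ∣ N` (`(2√(iM/4))⁴ = −M²`);
* §4 **`slash_flippedCusp_eq_theta_mul_bracket`**: for ANY `P` and `V = P·θ`: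
  `(V ∣_{k+1} γ₀)(z) = Θ(z) · B(z)`, **`B(z) = 8^{−(k+1)}·(P(γ₀•z)·(√(X/8)^{2k+1})⁻¹)`** — exactly the bracket P1 (`apply_translate_flippedCusp`,
  base `√(8(Mw+1))^{2k+1}`) and P3 (`junkTranslate_periodic_quarter`) normalise, times a harmless `8^{−(k+1)}`; no branch enters `B`
  (`(√Y)^{2k+2} = Y^{k+1}`); and `level_smul_add_div_eight`: `X/8 = 8(Mw + 1)` at `z = 64•w`.
The analytic half of P4 (periodicity/holomorphy/boundedness of `Θ` and `B` ⟹ `qExpansion N`, identification and integrality of the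
coefficients) is the sequel file. beyond-print theorem: NO.

References: [Shimura1973HalfIntegral] §1 (θ under `SL₂(ℤ)`); [KoblitzECMF1993] III §3, IV §1; crux notes w7g8-T6 v4 §5d (P4).
-/

-- summit-side namespace `Summit.BirchSwinnertonDyer.BirchSwinnertonDyer.…` (single-conjunct summit, D-0017 layout)
set_option linter.dupNamespace false

noncomputable section

open scoped MatrixGroups ModularForm Real Classical
open UpperHalfPlane hiding I
open Complex CongruenceSubgroup Function
open Literature.NumberTheory.EllipticCurves.ModularForms

namespace Summit.BirchSwinnertonDyer.BirchSwinnertonDyer.Theorems.PrintCFram.FlipRung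

/-! ## §1 The branch constant -/

/-- `Mz + 64 ∈ ℍ` for `M > 0`, `z ∈ ℍ`. [folklore] -/
theorem im_level_mul_add_sixtyfour_pos {M : ℕ} (hM : 0 < M) (z : ℍ) : 0 < ((M : ℂ) * z + 64).im := by
  have : ((M : ℂ) * z + 64).im = (M : ℝ) * z.im := by simp
  rw [this]; exact mul_pos (by exact_mod_cast hM) z.im_pos

/-- **THE BRANCH CONSTANT.** For `M > 0` and `X` in the upper half-plane, `√(2iM/X)·√(X/8) = √(iM/4)` (principal square roots;
`(iM/4)/(X/8) = 2iM/X` and the tree's `csqrt_div_mul_csqrt`: no sign because `X/8 ∈ ℍ`, `Im(iM/4) > 0`). [folklore] -/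
theorem csqrt_twoI_div_mul_csqrt_div_eight {M : ℕ} (hM : 0 < M) {X : ℂ} (hX : 0 < X.im) :
    Complex.sqrt (2 * I * M / X) * Complex.sqrt (X / 8) = Complex.sqrt (I * M / 4) := by
  have hX0 : X ≠ 0 := by intro h; rw [h] at hX; simp at hX
  have hu : 0 < (X / 8).im := by
    rw [show X / 8 = X / ((8 : ℝ) : ℂ) by norm_num, Complex.div_ofReal_im]; positivity
  have hMR : (0 : ℝ) < M := by exact_mod_cast hM
  have hYi' : (I * M / 4 : ℂ).im = (M : ℝ) / 4 := by
    rw [show (I * M / 4 : ℂ) = I * M / ((4 : ℝ) : ℂ) by norm_num, Complex.div_ofReal_im]; simp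
  have hY : (I * M / 4 : ℂ) ≠ 0 := by
    intro h; have := congrArg Complex.im h; rw [hYi'] at this; simp at this; linarith
  have hYi : 0 ≤ (I * M / 4 : ℂ).im := by rw [hYi']; positivity
  have hratio : (I * M / 4 : ℂ) / (X / 8) = 2 * I * M / X := by
    field_simp; ring
  rw [← hratio]
  exact csqrt_div_mul_csqrt hu hY hYi

/-! ## §2 The θ-factor at the flipped cusp -/

/-- `y ^ (1/2) = √y` (Mathlib's `Complex.sqrt` IS `cpow 2⁻¹`). [folklore] -/
theorem cpow_one_half_eq_csqrt (y : ℂ) : y ^ (1 / 2 : ℂ) = Complex.sqrt y := by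
  rw [Complex.sqrt, one_div]

/-- **THE θ-FACTOR.** For `γ₀ = [a b; M 64] ∈ SL₂(ℤ)` with `M > 0` and `z ∈ ℍ`, `X = Mz + 64`:
`θ(γ₀•z)·(√(X/8))⁻¹ = (√(iM/4))⁻¹ · Σ'_{k ∈ ℤ} exp(πi k² X/(2M))·G(a,k;M)` — the tree's transformation law
`shimuraTheta_smul_eq_tsum` (`θ(γz) = (2ic/(cz+d))^{−1/2} Σ_k …`) with the prefactor merged into P1's base by §1.
[cite: Shimura1973HalfIntegral, §1] [cite: KoblitzECMF1993, IV §1] -/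
theorem shimuraTheta_flippedCusp_mul_inv_csqrt (γ₀ : SL(2, ℤ)) {M : ℕ} [NeZero M] (hM : (γ₀ 1 0 : ℤ) = M)
    (h64 : (γ₀ 1 1 : ℤ) = 64) (z : ℍ) :
    shimuraTheta (γ₀ • z) * (Complex.sqrt (((M : ℂ) * z + 64) / 8))⁻¹ =
      (Complex.sqrt (I * M / 4))⁻¹ *
        ∑' k : ℤ, cexp (Real.pi * I * k ^ 2 * (((M : ℂ) * z + 64) / (2 * M))) * quadGaussSum M (γ₀ 0 0) k := by
  have hMpos : 0 < M := Nat.pos_of_ne_zero (NeZero.ne M)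
  have hX := im_level_mul_add_sixtyfour_pos hMpos z
  have hkey := csqrt_twoI_div_mul_csqrt_div_eight hMpos hX
  rw [shimuraTheta_smul_eq_tsum hM z, h64]
  push_cast
  rw [cpow_one_half_eq_csqrt, ← hkey, mul_inv, one_div]
  ring

/-- The termwise split `exp(πi k² X/(2M)) = exp(πi k² z/2)·exp(32πi k²/M)` for `X = Mz + 64` (`X/(2M) = z/2 + 32/M`). [folklore] -/
theorem cexp_thetaTerm_split {M : ℕ} (hM : 0 < M) (k : ℤ) (z : ℂ) :
    cexp (Real.pi * I * k ^ 2 * (((M : ℂ) * z + 64) / (2 * M))) =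
      cexp (Real.pi * I * k ^ 2 * (z / 2)) * cexp (32 * Real.pi * I * k ^ 2 / M) := by
  rw [← Complex.exp_add]
  congr 1
  have hM' : (M : ℂ) ≠ 0 := by exact_mod_cast hM.ne'
  field_simp
  ring

/-- `exp(πi k² z/2) = e(z/4)^{k²}`: the `θ`-factor is a series in the parameter `𝕢₄(z) = e(z/4)` (frequencies `k²`; at `z = 64w` these are
`e(16k²w)`, crux notes §5d). [folklore] -/
theorem cexp_pi_I_sq_mul_half_eq_qParam_pow (k : ℤ) (z : ℂ) :
    cexp (Real.pi * I * k ^ 2 * (z / 2)) = Periodic.qParam 4 z ^ (k.natAbs ^ 2) := by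
  have hk : ((k.natAbs : ℕ) : ℂ) ^ 2 = (k : ℂ) ^ 2 := by
    have h : ((k.natAbs : ℤ) : ℂ) ^ 2 = ((k ^ 2 : ℤ) : ℂ) := by
      rw [← Int.cast_pow, Int.natAbs_sq]
    rw [Int.cast_natCast, Int.cast_pow] at h
    exact h
  rw [Periodic.qParam, ← Complex.exp_nat_mul]
  congr 1
  push_cast
  rw [hk]
  ring

/-! ## §3 The constant `(√(iM/4))⁻¹` is a unit of `ℤ̄[1/N]` -/

/-- `(2·√(iM/4))⁴ = −M²`, so `2√(iM/4)` is an algebraic integer. [folklore] -/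
theorem isIntegral_two_mul_csqrt_I_mul_div_four (M : ℕ) : IsIntegral ℤ (2 * Complex.sqrt (I * M / 4)) := by
  have h2 : (2 * Complex.sqrt (I * M / 4)) ^ 2 = I * M := by rw [mul_pow, csqrt_sq]; ring
  have h4 : (2 * Complex.sqrt (I * M / 4)) ^ 4 = ((-((M : ℤ) ^ 2) : ℤ) : ℂ) := by
    rw [show (4 : ℕ) = 2 * 2 from rfl, pow_mul, h2, mul_pow, I_sq]; push_cast; ring
  refine IsIntegral.of_pow (by norm_num : 0 < 4) ?_
  rw [h4]
  exact isIntegral_intCast _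

/-- `√(iM/4) ∈ ℤ̄[1/N]` for `2 ∣ N` (`N·√(iM/4) = (N/2)·(2√(iM/4))`). [folklore] -/
theorem exists_isIntegral_pow_mul_csqrt_I_mul_div_four {N : ℕ} (hN : 2 ∣ N) (M : ℕ) :
    ∃ j : ℕ, IsIntegral ℤ ((N : ℂ) ^ j * Complex.sqrt (I * M / 4)) := by
  obtain ⟨n, rfl⟩ := hN
  refine ⟨1, ?_⟩
  have : (((2 * n : ℕ)) : ℂ) ^ 1 * Complex.sqrt (I * M / 4) = (n : ℂ) * (2 * Complex.sqrt (I * M / 4)) := by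
    push_cast; ring
  rw [this]
  exact (isIntegral_natCast n).mul (isIntegral_two_mul_csqrt_I_mul_div_four M)
where
  /-- naturals are algebraic integers -/
  isIntegral_natCast (n : ℕ) : IsIntegral ℤ ((n : ℂ)) := by exact_mod_cast isIntegral_intCast (n : ℤ)

/-- `i` is an algebraic integer (`i⁴ = 1`). [folklore] -/
theorem isIntegral_I : IsIntegral ℤ I :=
  IsIntegral.of_pow (by norm_num : 0 < 4) (by rw [I_pow_four]; exact isIntegral_one)

/-- **`(√(iM/4))⁻¹` is a unit of `ℤ̄[1/N]`** for `2 ∣ N`, `M ∣ N`, `M ≠ 0`: it lies in `ℤ̄[1/N]` (it equals `√(iM/4)·(−4i)·M⁻¹`) and its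
inverse `√(iM/4)` does too. In the NF-Q currency: `(√(iM/4))⁻¹ ∈ ℤ̄[1/N]` AND `∃ v ∈ ℤ̄[1/N], (√(iM/4))⁻¹·v = 1`. [folklore] -/
theorem csqrt_I_mul_div_four_inv_mem {N M : ℕ} (hN : 2 ∣ N) (hMN : M ∣ N) (hM : M ≠ 0) :
    (∃ j : ℕ, IsIntegral ℤ ((N : ℂ) ^ j * (Complex.sqrt (I * M / 4))⁻¹)) ∧
    ∃ v : ℂ, (∃ j : ℕ, IsIntegral ℤ ((N : ℂ) ^ j * v)) ∧ (Complex.sqrt (I * M / 4))⁻¹ * v = 1 := by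
  have hMC : (M : ℂ) ≠ 0 := by exact_mod_cast hM
  have hs2 : Complex.sqrt (I * M / 4) ^ 2 = I * M / 4 := csqrt_sq _
  have hne : (I * M / 4 : ℂ) ≠ 0 := by simp [hMC, I_ne_zero]
  have hs0 : Complex.sqrt (I * M / 4) ≠ 0 := by
    intro h0; rw [h0, zero_pow two_ne_zero] at hs2; exact hne hs2.symm
  refine ⟨?_, Complex.sqrt (I * M / 4), exists_isIntegral_pow_mul_csqrt_I_mul_div_four hN M, inv_mul_cancel₀ hs0⟩
  -- `(√(iM/4))⁻¹ = √(iM/4) · ((−4i) · M⁻¹)`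
  have hinv : (Complex.sqrt (I * M / 4))⁻¹ = Complex.sqrt (I * M / 4) * ((-4 * I) * (M : ℂ)⁻¹) := by
    have h1 : Complex.sqrt (I * M / 4) * (Complex.sqrt (I * M / 4) * ((-4 * I) * (M : ℂ)⁻¹)) = 1 := by
      rw [← mul_assoc, ← sq, hs2]
      field_simp
      simp only [I_sq, neg_neg]
    exact (eq_inv_of_mul_eq_one_right h1).symm
  rw [hinv]
  refine exists_isIntegral_pow_mul_mul (exists_isIntegral_pow_mul_csqrt_I_mul_div_four hN M)
    (exists_isIntegral_pow_mul_mul ?_ (exists_isIntegral_pow_mul_inv_of_dvd hM hMN))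
  have h4 : IsIntegral ℤ (-4 * I : ℂ) := by
    have h := (isIntegral_intCast (-4 : ℤ)).mul isIntegral_I
    push_cast at h
    exact h
  exact exists_isIntegral_pow_mul_of_isIntegral h4

/-! ## §4 The factorisation `V ∣ γ₀ = Θ · B` -/

/-- **THE FACTORISATION AT THE FLIPPED CUSP.** For `γ₀ = [a b; M 64] ∈ SL₂(ℤ)` (`M > 0`), ANY `P : ℍ → ℂ` and `V = P·θ`, every `k` and `z ∈ ℍ`,
with `X = Mz + 64` and `s = √(X/8)`:
`(V ∣_{k+1} γ₀)(z) = [θ(γ₀•z)·s⁻¹] · [8^{−(k+1)}·(P(γ₀•z)·(s^{2k+1})⁻¹)]` — `Θ · B` with `Θ` the θ-factor of §2 and `B` the bracket in P1's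
normalisation (`s = √(8(Mw+1))` at `z = 64w`). Only `(s²)^{k+1} = (X/8)^{k+1}` is used: no branch enters `B`.
[cite: Shimura1973HalfIntegral, §1] -/
theorem slash_flippedCusp_eq_theta_mul_bracket (γ₀ : SL(2, ℤ)) {M : ℕ} [NeZero M] (hM : (γ₀ 1 0 : ℤ) = M)
    (h64 : (γ₀ 1 1 : ℤ) = 64) (k : ℕ) {P V : ℍ → ℂ} (hV : ∀ z : ℍ, V z = P z * shimuraTheta z) (z : ℍ) :
    (V ∣[((k + 1 : ℕ) : ℤ)] γ₀) z =
      (shimuraTheta (γ₀ • z) * (Complex.sqrt (((M : ℂ) * z + 64) / 8))⁻¹) *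
        (((8 : ℂ)⁻¹) ^ (k + 1) * (P (γ₀ • z) * (Complex.sqrt (((M : ℂ) * z + 64) / 8) ^ (2 * k + 1))⁻¹)) := by
  have hMpos : 0 < M := Nat.pos_of_ne_zero (NeZero.ne M)
  have hX := im_level_mul_add_sixtyfour_pos hMpos z
  have hX0 : (M : ℂ) * z + 64 ≠ 0 := by intro h; rw [h] at hX; simp at hX
  set s : ℂ := Complex.sqrt (((M : ℂ) * z + 64) / 8) with hsdef
  have hs2 : s ^ 2 = ((M : ℂ) * z + 64) / 8 := csqrt_sq _
  have hs0 : s ≠ 0 := by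
    intro h0; rw [h0] at hs2
    have : (M : ℂ) * z + 64 = 0 := by
      have := hs2; field_simp at this; linear_combination -this
    exact hX0 this
  have hXs : (M : ℂ) * z + 64 = 8 * s ^ 2 := by rw [hs2]; field_simp
  rw [ModularForm.SL_slash_apply, hV, ModularGroup.denom_apply, hM, h64]
  simp only [Int.cast_natCast, Int.cast_ofNat]
  rw [hXs, zpow_neg, zpow_natCast, inv_pow]
  field_simp
  ring

/-- At `z = 64•w` the common base is P1's: `(M·(64•w) + 64)/8 = 8(Mw + 1)`. [folklore] -/
theorem level_smul_add_div_eight {M : ℕ} (c : {x : ℝ // 0 < x}) (hc : (c : ℝ) = 64) (w : ℍ) :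
    ((M : ℂ) * (((c • w : ℍ)) : ℂ) + 64) / 8 = 8 * ((M : ℂ) * w + 1) := by
  rw [coe_pos_real_smul, hc, Complex.real_smul]
  push_cast
  ring


end Summit.BirchSwinnertonDyer.BirchSwinnertonDyer.Theorems.PrintCFram.FlipRung

end
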